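import Summits.AtomisticToContinuum.Crystallization.Theorems.ExcessDecayLiouvilleHcpLiouvilleBlowdownGreenCrossB1
import Summits.AtomisticToContinuum.Crystallization.Theorems.ExcessDecayLiouvilleHcpLiouvilleBlowdownGreenOpticalA

/-!
# `ExcessDecayLiouville.HcpLiouville` (stmt-AtomisticToContinuum-9332), line `Sketch` v4: the cross-sublattice dipole is in `ℓ²`

Part H3d-III of stub `stub_green`, lead file.  From the cross-sublattice identity (part II),
`(G_a − G_b)(K_c ξ) = δ_a ξ − Σ_q T_q` with every `T_q` a lattice-translation difference of a point response, the
translation bounds (clause (iv) of `blowdown_greenSolve`, telescoped in `Blowdown.translate_sq_le`) and the countable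
Minkowski inequality give `‖(G_a − G_b)(K_c ξ)‖_{ℓ²} ≤ Γ ‖ξ‖` (`Blowdown.cross_sq_le`).  The optical matrix `K_c` is
coercive (`⟪K_c ξ, ξ⟫ ≥ κ ‖ξ‖²`, part H3c, hypothesis `hopt` here), hence onto with `κ ‖ξ‖ ≤ ‖K_c ξ‖`
(`Blowdown.opticalVec_surj`), and therefore `‖(G_a − G_b) η‖_{ℓ²} ≤ Γ ‖η‖ / κ` for EVERY vector `η`
(`Blowdown.cross_bound`) — the one genuinely two-lattice input of the dipole decomposition of the Green's operator.
All `[folklore]`; a `--supports` helper for item stmt-AtomisticToContinuum-9332, nothing here closes an item.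
-/

noncomputable section

namespace Summit.AtomisticToContinuum.Crystallization.Theorems.ExcessDecayLiouville

open scoped BigOperators Topology Classical InnerProductSpace RealInnerProductSpace
open Literature.MathematicalPhysics.StatisticalMechanics
open Summit.AtomisticToContinuum.Crystallization.Theses.ExcessDecayLiouville
open Summit.AtomisticToContinuum.Crystallization.Theorems.PhononStabilityNegative

namespace Blowdown

section

variable {t : Fin 2 → EuclideanSpace ℝ (Fin 3)} {A : EuclideanSpace ℝ (Fin 3) →L[ℝ] EuclideanSpace ℝ (Fin 3)}
  {𝒢 : (EuclideanSpace ℝ (Fin 3) → EuclideanSpace ℝ (Fin 3)) → EuclideanSpace ℝ (Fin 3) → EuclideanSpace ℝ (Fin 3)}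

/-! ## The optical vector map is onto -/

/-- **Coercivity of the optical vector map** `ξ ↦ K_c ξ = Σ_{q ∈ S₁} K(t 0 − q) ξ`: `κ ‖ξ‖² ≤ ⟪K_c ξ, ξ⟫` whenever the
optical row dominates `κ ‖ξ‖²` (hypothesis `hopt`, part H3c). [folklore] -/
theorem opticalVec_coercive (hA : Adm₀ A) (hI : Inner₀ t A) {κ : ℝ}
    (hopt : ∀ ξ : EuclideanSpace ℝ (Fin 3), κ * ‖ξ‖ ^ 2 ≤ ∑' z : Λ₀, ⟪forceConst (t 0 - (t 1 + A z)) ξ, ξ⟫)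
    (ξ : EuclideanSpace ℝ (Fin 3)) :
    κ * ‖ξ‖ ^ 2 ≤ ⟪∑' q : Sites₀ t A, (if ∃ z ∈ Λ₀, (q : EuclideanSpace ℝ (Fin 3)) = t 1 + A z then
      forceConst (t 0 - q) ξ else 0), ξ⟫ := by
  have hKs := summable_crossVec hA hI ξ
  have hinner : ⟪∑' q : Sites₀ t A, (if ∃ z ∈ Λ₀, (q : EuclideanSpace ℝ (Fin 3)) = t 1 + A z then
      forceConst (t 0 - q) ξ else 0), ξ⟫ =
      ∑' q : Sites₀ t A, (if ∃ z ∈ Λ₀, (q : EuclideanSpace ℝ (Fin 3)) = t 1 + A z then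
        ⟪forceConst (t 0 + A 0 - q) ξ, ξ⟫ else 0) := by
    rw [real_inner_comm, ← innerSL_apply_apply (𝕜 := ℝ), ContinuousLinearMap.map_tsum (innerSL ℝ ξ) hKs]
    refine tsum_congr fun q => ?_
    by_cases h1 : ∃ z ∈ Λ₀, (q : EuclideanSpace ℝ (Fin 3)) = t 1 + A z
    · rw [if_pos h1, if_pos h1, innerSL_apply_apply, real_inner_comm, map_zero, add_zero]
    · rw [if_neg h1, if_neg h1, map_zero]
  rw [hinner, tsum_cross_eq_optRow hA ξ zero_mem_Λ₀]
  exact hopt ξ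

/-- **The optical vector map is onto, with a bound**: every `η` is `K_c ξ` for some `ξ` with `κ ‖ξ‖ ≤ ‖η‖`. [folklore] -/
theorem opticalVec_surj (hA : Adm₀ A) (hI : Inner₀ t A) {κ : ℝ} (hκ : 0 < κ)
    (hopt : ∀ ξ : EuclideanSpace ℝ (Fin 3), κ * ‖ξ‖ ^ 2 ≤ ∑' z : Λ₀, ⟪forceConst (t 0 - (t 1 + A z)) ξ, ξ⟫)
    (η : EuclideanSpace ℝ (Fin 3)) :
    ∃ ξ : EuclideanSpace ℝ (Fin 3), (∑' q : Sites₀ t A, (if ∃ z ∈ Λ₀, (q : EuclideanSpace ℝ (Fin 3)) = t 1 + A z then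
      forceConst (t 0 - q) ξ else 0)) = η ∧ κ * ‖ξ‖ ≤ ‖η‖ := by
  -- the map as a linear map
  have hKs := fun ξ => summable_crossVec (t := t) (A := A) hA hI ξ
  let Kc : EuclideanSpace ℝ (Fin 3) →ₗ[ℝ] EuclideanSpace ℝ (Fin 3) :=
    { toFun := fun ξ => ∑' q : Sites₀ t A, (if ∃ z ∈ Λ₀, (q : EuclideanSpace ℝ (Fin 3)) = t 1 + A z then
        forceConst (t 0 - q) ξ else 0)
      map_add' := fun ξ ξ' => by
        rw [← (hKs ξ).tsum_add (hKs ξ')]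
        refine tsum_congr fun q => ?_
        split_ifs <;> simp [map_add]
      map_smul' := fun c ξ => by
        rw [RingHom.id_apply, ← (hKs ξ).tsum_const_smul c]
        refine tsum_congr fun q => ?_
        split_ifs <;> simp [map_smul] }
  have hKc : ∀ ξ, Kc ξ = ∑' q : Sites₀ t A, (if ∃ z ∈ Λ₀, (q : EuclideanSpace ℝ (Fin 3)) = t 1 + A z then
      forceConst (t 0 - q) ξ else 0) := fun ξ => rfl
  -- lower bound `κ ‖ξ‖ ≤ ‖Kc ξ‖`
  have hlow : ∀ ξ, κ * ‖ξ‖ ≤ ‖Kc ξ‖ := by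
    intro ξ
    have h1 := opticalVec_coercive hA hI hopt ξ
    rw [← hKc] at h1
    by_cases hξ : ξ = 0
    · simp [hξ]
    · have hpos : 0 < ‖ξ‖ := norm_pos_iff.2 hξ
      have h2 : ⟪Kc ξ, ξ⟫ ≤ ‖Kc ξ‖ * ‖ξ‖ := real_inner_le_norm _ _
      nlinarith
  have hinj : Function.Injective Kc := by
    intro ξ ξ' h
    have h0 : Kc (ξ - ξ') = 0 := by rw [map_sub, h, sub_self]
    have h1 := hlow (ξ - ξ')
    rw [h0, norm_zero] at h1
    have h2 : ‖ξ - ξ'‖ ≤ 0 := by nlinarith [norm_nonneg (ξ - ξ')]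
    exact sub_eq_zero.1 (norm_le_zero_iff.1 h2)
  have hsurj : Function.Surjective Kc := LinearMap.surjective_of_injective hinj
  obtain ⟨ξ, hξ⟩ := hsurj η
  exact ⟨ξ, by rw [← hKc, hξ], by rw [← hξ]; exact hlow ξ⟩


/-! ## `ℓ²` bound of one translated term -/

/-- **One term `T_q` in `ℓ²`**: for a site `c` and `q = c + A z` on the same sublattice, the translation difference
`x ↦ G_c η (x) − G_c η (x − q + c)` is square-summable over the sites with
`Σ' ≤ ((1000/189) · dist(c,q) · (C₂/κ) √C₁ ‖η‖)²` (clause (iv) telescoped along the lattice coordinates of `z`). [folklore] -/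
theorem translateTerm_sq_le (hA : Adm₀ A) {κ C₁ C₂ : ℝ} (hκ : 0 < κ) (hC₂ : 0 ≤ C₂)
    (hcap : ∀ w : EuclideanSpace ℝ (Fin 3) → EuclideanSpace ℝ (Fin 3), (Function.support w).Finite →
      Function.support w ⊆ Sites₀ t A → ∀ p ∈ Sites₀ t A, ‖w p‖ ^ 2 ≤ C₁ * nnForm t A w)
    (hiv : ∀ (f : EuclideanSpace ℝ (Fin 3) → EuclideanSpace ℝ (Fin 3)) (N : ℝ), 0 ≤ N →
      (∀ w : EuclideanSpace ℝ (Fin 3) → EuclideanSpace ℝ (Fin 3), (Function.support w).Finite → Function.support w ⊆ Sites₀ t A → |∑' p : Sites₀ t A, ⟪f p, w p⟫| ≤ N * Real.sqrt (nnForm t A w)) →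
      ∀ e ∈ ({triangularVec₁ 1, triangularVec₂ 1, layerNormal (2 * Real.sqrt (2 / 3))} : Finset (EuclideanSpace ℝ (Fin 3))),
        Summable (fun p : Sites₀ t A => ‖𝒢 f (p + A e) - 𝒢 f p‖ ^ 2) ∧
        ∑' p : Sites₀ t A, ‖𝒢 f (p + A e) - 𝒢 f p‖ ^ 2 ≤ (C₂ / κ * N) ^ 2)
    {c : EuclideanSpace ℝ (Fin 3)} (hc : c ∈ Sites₀ t A) {z : EuclideanSpace ℝ (Fin 3)} (hz : z ∈ Λ₀) (η : EuclideanSpace ℝ (Fin 3)) :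
    Summable (fun x : Sites₀ t A => ‖𝒢 (fun y : EuclideanSpace ℝ (Fin 3) => if y = c then η else 0) x -
        𝒢 (fun y : EuclideanSpace ℝ (Fin 3) => if y = c then η else 0) (x - (c + A z) + c)‖ ^ 2) ∧
      ∑' x : Sites₀ t A, ‖𝒢 (fun y : EuclideanSpace ℝ (Fin 3) => if y = c then η else 0) x -
        𝒢 (fun y : EuclideanSpace ℝ (Fin 3) => if y = c then η else 0) (x - (c + A z) + c)‖ ^ 2 ≤
        ((1000 / 189 : ℝ) * dist c (c + A z) * (C₂ / κ * (Real.sqrt C₁ * ‖η‖))) ^ 2 := by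
  obtain ⟨i, j, k, rfl⟩ := hz
  set G : EuclideanSpace ℝ (Fin 3) → EuclideanSpace ℝ (Fin 3) := 𝒢 (fun y : EuclideanSpace ℝ (Fin 3) => if y = c then η else 0) with hG
  have hN : 0 ≤ Real.sqrt C₁ * ‖η‖ := by positivity
  have hB : 0 ≤ C₂ / κ * (Real.sqrt C₁ * ‖η‖) := by positivity
  have hstep := hiv (fun y : EuclideanSpace ℝ (Fin 3) => if y = c then η else 0) (Real.sqrt C₁ * ‖η‖) hN (adm_single (t := t) (A := A) hcap hc η)
  have h := translate_sq_le (t := t) (A := A) G hB hstep i j k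
  have heq : ∀ x : Sites₀ t A, (x : EuclideanSpace ℝ (Fin 3)) - (c + A ((i : ℝ) • triangularVec₁ 1 + (j : ℝ) • triangularVec₂ 1 +
      (k : ℝ) • layerNormal (2 * Real.sqrt (2 / 3)))) + c =
      (x : EuclideanSpace ℝ (Fin 3)) - A ((i : ℝ) • triangularVec₁ 1 + (j : ℝ) • triangularVec₂ 1 + (k : ℝ) • layerNormal (2 * Real.sqrt (2 / 3))) := by
    intro x; abel
  simp only [heq]
  refine ⟨h.1, h.2.trans ?_⟩
  obtain ⟨hi, hj, hk⟩ := abs_coord_le_norm_apply_latticeVec hA i j k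
  have hd : dist c (c + A ((i : ℝ) • triangularVec₁ 1 + (j : ℝ) • triangularVec₂ 1 + (k : ℝ) • layerNormal (2 * Real.sqrt (2 / 3)))) =
      ‖A ((i : ℝ) • triangularVec₁ 1 + (j : ℝ) • triangularVec₂ 1 + (k : ℝ) • layerNormal (2 * Real.sqrt (2 / 3)))‖ := by
    rw [dist_eq_norm, sub_add_cancel_left, norm_neg]
  rw [hd]
  have hsum : |(i : ℝ)| + |(j : ℝ)| + |(k : ℝ)| ≤ 1000 / 189 *
      ‖A ((i : ℝ) • triangularVec₁ 1 + (j : ℝ) • triangularVec₂ 1 + (k : ℝ) • layerNormal (2 * Real.sqrt (2 / 3)))‖ := by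
    linarith [norm_nonneg (A ((i : ℝ) • triangularVec₁ 1 + (j : ℝ) • triangularVec₂ 1 + (k : ℝ) • layerNormal (2 * Real.sqrt (2 / 3))))]
  have h0 : 0 ≤ |(i : ℝ)| + |(j : ℝ)| + |(k : ℝ)| := by positivity
  exact pow_le_pow_left₀ (mul_nonneg h0 hB) (mul_le_mul_of_nonneg_right hsum hB) 2

/-! ## `(G_a − G_b)(K_c ξ)` in `ℓ²` -/

/-- **`(G_a − G_b)(K_c ξ)` is square-summable**, with `Σ'_x ‖·‖² ≤ ((1 + 38 L K_w) ‖ξ‖)²`,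
`L = (1100/189)(C₂/κ)√C₁`, `K_w` the universal kernel constant. [folklore] -/
theorem cross_sq_le (hA : Adm₀ A) (hI : Inner₀ t A) {κ C₀ C₁ C₂ : ℝ} (hκ : 0 < κ) (hC₀ : 0 ≤ C₀) (hC₂ : 0 ≤ C₂)
    (hpath : ∀ w : EuclideanSpace ℝ (Fin 3) → EuclideanSpace ℝ (Fin 3), (Function.support w).Finite →
      Function.support w ⊆ Sites₀ t A → ∀ p ∈ Sites₀ t A, ∀ q ∈ Sites₀ t A,
        ‖w p - w q‖ ≤ C₀ * (1 + dist p q) * Real.sqrt (nnForm t A w))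
    (hcap : ∀ w : EuclideanSpace ℝ (Fin 3) → EuclideanSpace ℝ (Fin 3), (Function.support w).Finite →
      Function.support w ⊆ Sites₀ t A → ∀ p ∈ Sites₀ t A, ‖w p‖ ^ 2 ≤ C₁ * nnForm t A w)
    (hiv : ∀ (f : EuclideanSpace ℝ (Fin 3) → EuclideanSpace ℝ (Fin 3)) (N : ℝ), 0 ≤ N →
      (∀ w : EuclideanSpace ℝ (Fin 3) → EuclideanSpace ℝ (Fin 3), (Function.support w).Finite → Function.support w ⊆ Sites₀ t A → |∑' p : Sites₀ t A, ⟪f p, w p⟫| ≤ N * Real.sqrt (nnForm t A w)) →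
      ∀ e ∈ ({triangularVec₁ 1, triangularVec₂ 1, layerNormal (2 * Real.sqrt (2 / 3))} : Finset (EuclideanSpace ℝ (Fin 3))),
        Summable (fun p : Sites₀ t A => ‖𝒢 f (p + A e) - 𝒢 f p‖ ^ 2) ∧
        ∑' p : Sites₀ t A, ‖𝒢 f (p + A e) - 𝒢 f p‖ ^ 2 ≤ (C₂ / κ * N) ^ 2)
    (hv : ∀ (f : EuclideanSpace ℝ (Fin 3) → EuclideanSpace ℝ (Fin 3)) (N : ℝ), 0 ≤ N →
      (∀ w : EuclideanSpace ℝ (Fin 3) → EuclideanSpace ℝ (Fin 3), (Function.support w).Finite → Function.support w ⊆ Sites₀ t A → |∑' p : Sites₀ t A, ⟪f p, w p⟫| ≤ N * Real.sqrt (nnForm t A w)) →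
      ∀ c : ℝ, ∀ p ∈ Sites₀ t A, 𝒢 (c • f) p = c • 𝒢 f p)
    (hvi : ∀ (f : EuclideanSpace ℝ (Fin 3) → EuclideanSpace ℝ (Fin 3)) (N : ℝ), 0 ≤ N →
      (∀ w : EuclideanSpace ℝ (Fin 3) → EuclideanSpace ℝ (Fin 3), (Function.support w).Finite → Function.support w ⊆ Sites₀ t A → |∑' p : Sites₀ t A, ⟪f p, w p⟫| ≤ N * Real.sqrt (nnForm t A w)) →
      ∀ e ∈ Λ₀, (∀ w : EuclideanSpace ℝ (Fin 3) → EuclideanSpace ℝ (Fin 3), (Function.support w).Finite → Function.support w ⊆ Sites₀ t A → |∑' p : Sites₀ t A, ⟪(fun x => f (x - A e)) p, w p⟫| ≤ N * Real.sqrt (nnForm t A w)) →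
      ∀ p ∈ Sites₀ t A, 𝒢 (fun x => f (x - A e)) p = 𝒢 f (p - A e))
    (hvii : ∀ (f g : EuclideanSpace ℝ (Fin 3) → EuclideanSpace ℝ (Fin 3)) (Nf Ng : ℝ), 0 ≤ Nf → 0 ≤ Ng →
      (∀ w : EuclideanSpace ℝ (Fin 3) → EuclideanSpace ℝ (Fin 3), (Function.support w).Finite → Function.support w ⊆ Sites₀ t A → |∑' p : Sites₀ t A, ⟪f p, w p⟫| ≤ Nf * Real.sqrt (nnForm t A w)) →
      (∀ w : EuclideanSpace ℝ (Fin 3) → EuclideanSpace ℝ (Fin 3), (Function.support w).Finite → Function.support w ⊆ Sites₀ t A → |∑' p : Sites₀ t A, ⟪g p, w p⟫| ≤ Ng * Real.sqrt (nnForm t A w)) →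
      ∀ p ∈ Sites₀ t A, 𝒢 (f + g) p = 𝒢 f p + 𝒢 g p)
    (hviii : ∀ (ι : Type) (F : ι → EuclideanSpace ℝ (Fin 3) → EuclideanSpace ℝ (Fin 3)) (Nn : ι → ℝ)
      (f : EuclideanSpace ℝ (Fin 3) → EuclideanSpace ℝ (Fin 3)), (∀ n, 0 ≤ Nn n) → Summable Nn →
      (∀ n, (∀ w : EuclideanSpace ℝ (Fin 3) → EuclideanSpace ℝ (Fin 3), (Function.support w).Finite → Function.support w ⊆ Sites₀ t A → |∑' p : Sites₀ t A, ⟪(F n) p, w p⟫| ≤ Nn n * Real.sqrt (nnForm t A w))) →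
      (∀ p ∈ Sites₀ t A, HasSum (fun n => F n p) (f p)) → ∀ p ∈ Sites₀ t A, HasSum (fun n => 𝒢 (F n) p) (𝒢 f p))
    (hix : ∀ φ : EuclideanSpace ℝ (Fin 3) → EuclideanSpace ℝ (Fin 3), (Function.support φ).Finite → Function.support φ ⊆ Sites₀ t A →
      ∀ (g : EuclideanSpace ℝ (Fin 3) → EuclideanSpace ℝ (Fin 3)) (N : ℝ), 0 ≤ N →
      (∀ p : Sites₀ t A, HasSum (fun q : Sites₀ t A => forceConst ((p : EuclideanSpace ℝ (Fin 3)) - q) (φ p - φ q)) (g p)) →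
      (∀ w : EuclideanSpace ℝ (Fin 3) → EuclideanSpace ℝ (Fin 3), (Function.support w).Finite → Function.support w ⊆ Sites₀ t A → |∑' p : Sites₀ t A, ⟪g p, w p⟫| ≤ N * Real.sqrt (nnForm t A w)) →
      ∀ p ∈ Sites₀ t A, 𝒢 g p = φ p)
    (ξ : EuclideanSpace ℝ (Fin 3)) :
    Summable (fun x : Sites₀ t A => ‖𝒢 (fun y : EuclideanSpace ℝ (Fin 3) => if y = t 0 then (∑' q : Sites₀ t A, (if (∃ z ∈ Λ₀, (q : EuclideanSpace ℝ (Fin 3)) = t 1 + A z) then forceConst (t 0 - q) ξ else 0)) else 0) x - 𝒢 (fun y : EuclideanSpace ℝ (Fin 3) => if y = t 1 then (∑' q : Sites₀ t A, (if (∃ z ∈ Λ₀, (q : EuclideanSpace ℝ (Fin 3)) = t 1 + A z) then forceConst (t 0 - q) ξ else 0)) else 0) x‖ ^ 2) ∧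
      ∑' x : Sites₀ t A, ‖𝒢 (fun y : EuclideanSpace ℝ (Fin 3) => if y = t 0 then (∑' q : Sites₀ t A, (if (∃ z ∈ Λ₀, (q : EuclideanSpace ℝ (Fin 3)) = t 1 + A z) then forceConst (t 0 - q) ξ else 0)) else 0) x - 𝒢 (fun y : EuclideanSpace ℝ (Fin 3) => if y = t 1 then (∑' q : Sites₀ t A, (if (∃ z ∈ Λ₀, (q : EuclideanSpace ℝ (Fin 3)) = t 1 + A z) then forceConst (t 0 - q) ξ else 0)) else 0) x‖ ^ 2 ≤
        ((1 + 38 * ((1100 / 189 : ℝ) * (C₂ / κ * Real.sqrt C₁)) * (1024 / ((23 / 25 : ℝ) ^ 3 * (23 / 25 : ℝ) ^ 5) + 1024 / ((23 / 25 : ℝ) ^ 3 * (23 / 25 : ℝ) ^ 4))) * ‖ξ‖) ^ 2 := by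
  have ha : t 0 ∈ Sites₀ t A := ⟨0, 0, zero_mem_Λ₀, by simp⟩
  have hb : t 1 ∈ Sites₀ t A := ⟨1, 0, zero_mem_Λ₀, by simp⟩
  set a₀ : Sites₀ t A := ⟨t 0, ha⟩ with ha₀
  set L : ℝ := (1100 / 189 : ℝ) * (C₂ / κ * Real.sqrt C₁) with hL
  have hL0 : 0 ≤ L := by positivity
  -- the family `h` and its bounds `β`
  set T : Sites₀ t A → EuclideanSpace ℝ (Fin 3) → EuclideanSpace ℝ (Fin 3) := fun q x => ((if (∃ z ∈ Λ₀, (q : EuclideanSpace ℝ (Fin 3)) = t 1 + A z) then 𝒢 (fun y : EuclideanSpace ℝ (Fin 3) => if y = t 1 then forceConst (t 0 - q) ξ else 0) x - 𝒢 (fun y : EuclideanSpace ℝ (Fin 3) => if y = t 1 then forceConst (t 0 - q) ξ else 0) (x - q + t 1) else 0) +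
        (if (∃ z ∈ Λ₀, (q : EuclideanSpace ℝ (Fin 3)) = t 0 + A z) then 𝒢 (fun y : EuclideanSpace ℝ (Fin 3) => if y = t 0 then forceConst (t 0 - q) ξ else 0) x - 𝒢 (fun y : EuclideanSpace ℝ (Fin 3) => if y = t 0 then forceConst (t 0 - q) ξ else 0) (x - q + t 0) else 0)) with hT
  set φ : EuclideanSpace ℝ (Fin 3) → EuclideanSpace ℝ (Fin 3) := fun y => if y = t 0 then ξ else 0 with hφ
  set D : EuclideanSpace ℝ (Fin 3) → EuclideanSpace ℝ (Fin 3) := fun x => 𝒢 (fun y : EuclideanSpace ℝ (Fin 3) => if y = t 0 then (∑' q : Sites₀ t A, (if (∃ z ∈ Λ₀, (q : EuclideanSpace ℝ (Fin 3)) = t 1 + A z) then forceConst (t 0 - q) ξ else 0)) else 0) x - 𝒢 (fun y : EuclideanSpace ℝ (Fin 3) => if y = t 1 then (∑' q : Sites₀ t A, (if (∃ z ∈ Λ₀, (q : EuclideanSpace ℝ (Fin 3)) = t 1 + A z) then forceConst (t 0 - q) ξ else 0)) else 0) x with hD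
  set h : Sites₀ t A → Sites₀ t A → EuclideanSpace ℝ (Fin 3) := fun q x => if q = a₀ then φ x else -T q x with hh
  set β : Sites₀ t A → ℝ := fun q => (if q = a₀ then ‖ξ‖ else 0) + L * ((1 + dist (t 0) (q : EuclideanSpace ℝ (Fin 3))) * ‖forceConst (t 0 - q) ξ‖) with hβ
  -- `T a₀ = 0`
  have hTa : ∀ x : Sites₀ t A, T a₀ x = 0 := by
    intro x
    have h1 : ¬ (∃ z ∈ Λ₀, ((a₀ : Sites₀ t A) : EuclideanSpace ℝ (Fin 3)) = t 1 + A z) := fun ⟨z, hz, h⟩ => sublattice_ne hA hI zero_mem_Λ₀ hz (by simpa using h)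
    have h0 : (∃ z ∈ Λ₀, ((a₀ : Sites₀ t A) : EuclideanSpace ℝ (Fin 3)) = t 0 + A z) := ⟨0, zero_mem_Λ₀, by simp [ha₀]⟩
    simp only [hT]
    rw [if_neg h1, if_pos h0, zero_add]
    have hx : (x : EuclideanSpace ℝ (Fin 3)) - (a₀ : EuclideanSpace ℝ (Fin 3)) + t 0 = x := by
      simp only [ha₀]; abel
    rw [hx, sub_self]
  -- pointwise `HasSum`
  have hHas : ∀ x : Sites₀ t A, HasSum (fun q => h q x) (D x) := by
    intro x
    have hci := cross_identity (𝒢 := 𝒢) hA hI hC₀ hpath hcap hv hvi hvii hviii hix ξ x.2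
    have h1 : HasSum (fun q : Sites₀ t A => -T q x) (-(φ x - D x)) := hci.neg
    have h2 : HasSum (fun q : Sites₀ t A => if q = a₀ then φ x else (0 : EuclideanSpace ℝ (Fin 3))) (φ x) := hasSum_ite_eq a₀ (φ x)
    have h3 := h1.add h2
    have hval : -(φ x - D x) + φ x = D x := by abel
    rw [hval] at h3
    have hfun : (fun q => h q x) = fun q : Sites₀ t A => -T q x + (if q = a₀ then φ x else (0 : EuclideanSpace ℝ (Fin 3))) := by
      funext q
      simp only [hh]
      by_cases hq : q = a₀
      · rw [if_pos hq, if_pos hq, hq, hTa, neg_zero, zero_add]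
      · rw [if_neg hq, if_neg hq, add_zero]
    rw [hfun]
    exact h3
  -- the bounds `Σ_x ‖h q x‖² ≤ (β q)²`
  have hβ0 : ∀ q, 0 ≤ β q := fun q => by simp only [hβ]; positivity
  have hbound : ∀ q : Sites₀ t A, Summable (fun x : Sites₀ t A => ‖h q x‖ ^ 2) ∧ ∑' x : Sites₀ t A, ‖h q x‖ ^ 2 ≤ β q ^ 2 := by
    intro q
    by_cases hq : q = a₀
    · -- the point field
      have hfun : (fun x : Sites₀ t A => ‖h q x‖ ^ 2) = fun x => if x = a₀ then ‖ξ‖ ^ 2 else 0 := by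
        funext x
        simp only [hh, if_pos hq, hφ]
        by_cases hx : x = a₀
        · rw [if_pos hx, hx]; simp [ha₀]
        · have hx' : (x : EuclideanSpace ℝ (Fin 3)) ≠ t 0 := fun h' => hx (Subtype.ext h')
          rw [if_neg hx, if_neg hx', norm_zero, zero_pow two_ne_zero]
      rw [hfun]
      refine ⟨(hasSum_ite_eq a₀ _).summable, ?_⟩
      rw [tsum_ite_eq]
      simp only [hβ, if_pos hq]
      nlinarith [norm_nonneg ξ, mul_nonneg hL0 (mul_nonneg (by positivity : (0 : ℝ) ≤ 1 + dist (t 0) (q : EuclideanSpace ℝ (Fin 3))) (norm_nonneg (forceConst (t 0 - q) ξ)))]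
    · -- a translated term
      have hfun : (fun x : Sites₀ t A => ‖h q x‖ ^ 2) = fun x : Sites₀ t A => ‖T q x‖ ^ 2 := by
        funext x; simp only [hh, if_neg hq, norm_neg]
      rw [hfun]
      have hβq : β q = L * ((1 + dist (t 0) (q : EuclideanSpace ℝ (Fin 3))) * ‖forceConst (t 0 - q) ξ‖) := by
        simp only [hβ, if_neg hq, zero_add]
      rw [hβq]
      rcases sublattice_cases hA hI q with ⟨h0q, h1q⟩ | ⟨h0q, h1q⟩
      · obtain ⟨z, hz, hqz⟩ := h0q
        have hTq : ∀ x : Sites₀ t A, T q x = 𝒢 (fun y : EuclideanSpace ℝ (Fin 3) => if y = t 0 then forceConst (t 0 - q) ξ else 0) x - 𝒢 (fun y : EuclideanSpace ℝ (Fin 3) => if y = t 0 then forceConst (t 0 - q) ξ else 0) (x - (t 0 + A z) + t 0) := by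
          intro x; simp only [hT]; rw [if_neg h1q, if_pos (⟨z, hz, hqz⟩ : (∃ z ∈ Λ₀, (q : EuclideanSpace ℝ (Fin 3)) = t 0 + A z)), zero_add, ← hqz]
        simp only [hTq]
        have h := translateTerm_sq_le (𝒢 := 𝒢) hA hκ hC₂ hcap hiv ha hz (forceConst (t 0 - q) ξ)
        refine ⟨h.1, h.2.trans ?_⟩
        have hd : dist (t 0) (t 0 + A z) = dist (t 0) (q : EuclideanSpace ℝ (Fin 3)) := by rw [hqz]
        rw [hd]
        have hkey : (1000 / 189 : ℝ) * dist (t 0) (q : EuclideanSpace ℝ (Fin 3)) * (C₂ / κ * (Real.sqrt C₁ * ‖forceConst (t 0 - ↑q) ξ‖)) ≤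
            L * ((1 + dist (t 0) (q : EuclideanSpace ℝ (Fin 3))) * ‖forceConst (t 0 - q) ξ‖) := by
          rw [hL]
          have hdn : 0 ≤ dist (t 0) (q : EuclideanSpace ℝ (Fin 3)) := dist_nonneg
          have hX : 0 ≤ C₂ / κ * Real.sqrt C₁ * ‖forceConst (t 0 - q) ξ‖ := by positivity
          nlinarith
        exact pow_le_pow_left₀ (by positivity) hkey 2
      · obtain ⟨z, hz, hqz⟩ := h1q
        have hTq : ∀ x : Sites₀ t A, T q x = 𝒢 (fun y : EuclideanSpace ℝ (Fin 3) => if y = t 1 then forceConst (t 0 - q) ξ else 0) x - 𝒢 (fun y : EuclideanSpace ℝ (Fin 3) => if y = t 1 then forceConst (t 0 - q) ξ else 0) (x - (t 1 + A z) + t 1) := by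
          intro x; simp only [hT]; rw [if_pos (⟨z, hz, hqz⟩ : (∃ z ∈ Λ₀, (q : EuclideanSpace ℝ (Fin 3)) = t 1 + A z)), if_neg h0q, add_zero, ← hqz]
        simp only [hTq]
        have h := translateTerm_sq_le (𝒢 := 𝒢) hA hκ hC₂ hcap hiv hb hz (forceConst (t 0 - q) ξ)
        refine ⟨h.1, h.2.trans ?_⟩
        have hd : dist (t 1) (t 1 + A z) ≤ dist (t 0) (q : EuclideanSpace ℝ (Fin 3)) + 11 / 10 := by
          rw [← hqz]
          calc dist (t 1) (q : EuclideanSpace ℝ (Fin 3)) ≤ dist (t 1) (t 0) + dist (t 0) q := dist_triangle _ _ _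
            _ ≤ 11 / 10 + dist (t 0) q := by rw [dist_eq_norm]; exact add_le_add (norm_t_sub_t_le hA hI) le_rfl
            _ = _ := add_comm _ _
        have hkey : (1000 / 189 : ℝ) * dist (t 1) (t 1 + A z) * (C₂ / κ * (Real.sqrt C₁ * ‖forceConst (t 0 - ↑q) ξ‖)) ≤
            L * ((1 + dist (t 0) (q : EuclideanSpace ℝ (Fin 3))) * ‖forceConst (t 0 - q) ξ‖) := by
          rw [hL]
          have hdn : 0 ≤ dist (t 0) (q : EuclideanSpace ℝ (Fin 3)) := dist_nonneg
          have hX : 0 ≤ C₂ / κ * Real.sqrt C₁ * ‖forceConst (t 0 - q) ξ‖ := by positivity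
          nlinarith
        exact pow_le_pow_left₀ (by positivity) hkey 2
  -- summability of `β` and its sum
  obtain ⟨hNs, hNle⟩ := summable_dipole_bounds hA hI zero_le_one ha ξ
  simp only [one_mul] at hNs hNle
  have hβs : Summable β := (hasSum_ite_eq a₀ ‖ξ‖).summable.add (hNs.mul_left L)
  have hβle : ∑' q, β q ≤ (1 + 38 * L * (1024 / ((23 / 25 : ℝ) ^ 3 * (23 / 25 : ℝ) ^ 5) + 1024 / ((23 / 25 : ℝ) ^ 3 * (23 / 25 : ℝ) ^ 4))) * ‖ξ‖ := by
    rw [hβ, (hasSum_ite_eq a₀ ‖ξ‖).summable.tsum_add (hNs.mul_left L), tsum_ite_eq, tsum_mul_left]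
    nlinarith [hNle, hL0]
  have hmain := tsum_norm_sq_le_of_hasSum h (fun x : Sites₀ t A => D x) β hβ0 hβs hbound hHas
  refine ⟨hmain.1, hmain.2.trans ?_⟩
  exact pow_le_pow_left₀ (tsum_nonneg hβ0) hβle 2

/-- **The cross-sublattice point-response difference is in `ℓ²`**: for EVERY vector `η`,
`Σ'_x ‖G_a η (x) − G_b η (x)‖² ≤ ((1 + 38 L K_w) ‖η‖ / κ)²`. [folklore] -/
theorem cross_bound (hA : Adm₀ A) (hI : Inner₀ t A) {κ C₀ C₁ C₂ : ℝ} (hκ : 0 < κ) (hC₀ : 0 ≤ C₀) (hC₂ : 0 ≤ C₂)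
    (hpath : ∀ w : EuclideanSpace ℝ (Fin 3) → EuclideanSpace ℝ (Fin 3), (Function.support w).Finite →
      Function.support w ⊆ Sites₀ t A → ∀ p ∈ Sites₀ t A, ∀ q ∈ Sites₀ t A,
        ‖w p - w q‖ ≤ C₀ * (1 + dist p q) * Real.sqrt (nnForm t A w))
    (hcap : ∀ w : EuclideanSpace ℝ (Fin 3) → EuclideanSpace ℝ (Fin 3), (Function.support w).Finite →
      Function.support w ⊆ Sites₀ t A → ∀ p ∈ Sites₀ t A, ‖w p‖ ^ 2 ≤ C₁ * nnForm t A w)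
    (hiv : ∀ (f : EuclideanSpace ℝ (Fin 3) → EuclideanSpace ℝ (Fin 3)) (N : ℝ), 0 ≤ N →
      (∀ w : EuclideanSpace ℝ (Fin 3) → EuclideanSpace ℝ (Fin 3), (Function.support w).Finite → Function.support w ⊆ Sites₀ t A → |∑' p : Sites₀ t A, ⟪f p, w p⟫| ≤ N * Real.sqrt (nnForm t A w)) →
      ∀ e ∈ ({triangularVec₁ 1, triangularVec₂ 1, layerNormal (2 * Real.sqrt (2 / 3))} : Finset (EuclideanSpace ℝ (Fin 3))),
        Summable (fun p : Sites₀ t A => ‖𝒢 f (p + A e) - 𝒢 f p‖ ^ 2) ∧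
        ∑' p : Sites₀ t A, ‖𝒢 f (p + A e) - 𝒢 f p‖ ^ 2 ≤ (C₂ / κ * N) ^ 2)
    (hv : ∀ (f : EuclideanSpace ℝ (Fin 3) → EuclideanSpace ℝ (Fin 3)) (N : ℝ), 0 ≤ N →
      (∀ w : EuclideanSpace ℝ (Fin 3) → EuclideanSpace ℝ (Fin 3), (Function.support w).Finite → Function.support w ⊆ Sites₀ t A → |∑' p : Sites₀ t A, ⟪f p, w p⟫| ≤ N * Real.sqrt (nnForm t A w)) →
      ∀ c : ℝ, ∀ p ∈ Sites₀ t A, 𝒢 (c • f) p = c • 𝒢 f p)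
    (hvi : ∀ (f : EuclideanSpace ℝ (Fin 3) → EuclideanSpace ℝ (Fin 3)) (N : ℝ), 0 ≤ N →
      (∀ w : EuclideanSpace ℝ (Fin 3) → EuclideanSpace ℝ (Fin 3), (Function.support w).Finite → Function.support w ⊆ Sites₀ t A → |∑' p : Sites₀ t A, ⟪f p, w p⟫| ≤ N * Real.sqrt (nnForm t A w)) →
      ∀ e ∈ Λ₀, (∀ w : EuclideanSpace ℝ (Fin 3) → EuclideanSpace ℝ (Fin 3), (Function.support w).Finite → Function.support w ⊆ Sites₀ t A → |∑' p : Sites₀ t A, ⟪(fun x => f (x - A e)) p, w p⟫| ≤ N * Real.sqrt (nnForm t A w)) →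
      ∀ p ∈ Sites₀ t A, 𝒢 (fun x => f (x - A e)) p = 𝒢 f (p - A e))
    (hvii : ∀ (f g : EuclideanSpace ℝ (Fin 3) → EuclideanSpace ℝ (Fin 3)) (Nf Ng : ℝ), 0 ≤ Nf → 0 ≤ Ng →
      (∀ w : EuclideanSpace ℝ (Fin 3) → EuclideanSpace ℝ (Fin 3), (Function.support w).Finite → Function.support w ⊆ Sites₀ t A → |∑' p : Sites₀ t A, ⟪f p, w p⟫| ≤ Nf * Real.sqrt (nnForm t A w)) →
      (∀ w : EuclideanSpace ℝ (Fin 3) → EuclideanSpace ℝ (Fin 3), (Function.support w).Finite → Function.support w ⊆ Sites₀ t A → |∑' p : Sites₀ t A, ⟪g p, w p⟫| ≤ Ng * Real.sqrt (nnForm t A w)) →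
      ∀ p ∈ Sites₀ t A, 𝒢 (f + g) p = 𝒢 f p + 𝒢 g p)
    (hviii : ∀ (ι : Type) (F : ι → EuclideanSpace ℝ (Fin 3) → EuclideanSpace ℝ (Fin 3)) (Nn : ι → ℝ)
      (f : EuclideanSpace ℝ (Fin 3) → EuclideanSpace ℝ (Fin 3)), (∀ n, 0 ≤ Nn n) → Summable Nn →
      (∀ n, (∀ w : EuclideanSpace ℝ (Fin 3) → EuclideanSpace ℝ (Fin 3), (Function.support w).Finite → Function.support w ⊆ Sites₀ t A → |∑' p : Sites₀ t A, ⟪(F n) p, w p⟫| ≤ Nn n * Real.sqrt (nnForm t A w))) →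
      (∀ p ∈ Sites₀ t A, HasSum (fun n => F n p) (f p)) → ∀ p ∈ Sites₀ t A, HasSum (fun n => 𝒢 (F n) p) (𝒢 f p))
    (hix : ∀ φ : EuclideanSpace ℝ (Fin 3) → EuclideanSpace ℝ (Fin 3), (Function.support φ).Finite → Function.support φ ⊆ Sites₀ t A →
      ∀ (g : EuclideanSpace ℝ (Fin 3) → EuclideanSpace ℝ (Fin 3)) (N : ℝ), 0 ≤ N →
      (∀ p : Sites₀ t A, HasSum (fun q : Sites₀ t A => forceConst ((p : EuclideanSpace ℝ (Fin 3)) - q) (φ p - φ q)) (g p)) →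
      (∀ w : EuclideanSpace ℝ (Fin 3) → EuclideanSpace ℝ (Fin 3), (Function.support w).Finite → Function.support w ⊆ Sites₀ t A → |∑' p : Sites₀ t A, ⟪g p, w p⟫| ≤ N * Real.sqrt (nnForm t A w)) →
      ∀ p ∈ Sites₀ t A, 𝒢 g p = φ p)
    (hopt : ∀ ξ : EuclideanSpace ℝ (Fin 3), κ * ‖ξ‖ ^ 2 ≤ ∑' z : Λ₀, ⟪forceConst (t 0 - (t 1 + A z)) ξ, ξ⟫)
    (η : EuclideanSpace ℝ (Fin 3)) :
    Summable (fun x : Sites₀ t A => ‖𝒢 (fun y : EuclideanSpace ℝ (Fin 3) => if y = t 0 then η else 0) x -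
        𝒢 (fun y : EuclideanSpace ℝ (Fin 3) => if y = t 1 then η else 0) x‖ ^ 2) ∧
      ∑' x : Sites₀ t A, ‖𝒢 (fun y : EuclideanSpace ℝ (Fin 3) => if y = t 0 then η else 0) x -
        𝒢 (fun y : EuclideanSpace ℝ (Fin 3) => if y = t 1 then η else 0) x‖ ^ 2 ≤
        ((1 + 38 * ((1100 / 189 : ℝ) * (C₂ / κ * Real.sqrt C₁)) * (1024 / ((23 / 25 : ℝ) ^ 3 * (23 / 25 : ℝ) ^ 5) + 1024 / ((23 / 25 : ℝ) ^ 3 * (23 / 25 : ℝ) ^ 4))) / κ * ‖η‖) ^ 2 := by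
  obtain ⟨ξ, hξ, hξle⟩ := opticalVec_surj hA hI hκ hopt η
  subst hξ
  have h := cross_sq_le (𝒢 := 𝒢) hA hI hκ hC₀ hC₂ hpath hcap hiv hv hvi hvii hviii hix ξ
  refine ⟨h.1, h.2.trans (pow_le_pow_left₀ (by positivity) ?_ 2)⟩
  set X : ℝ := 1 + 38 * ((1100 / 189 : ℝ) * (C₂ / κ * Real.sqrt C₁)) * (1024 / ((23 / 25 : ℝ) ^ 3 * (23 / 25 : ℝ) ^ 5) + 1024 / ((23 / 25 : ℝ) ^ 3 * (23 / 25 : ℝ) ^ 4)) with hX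
  have hX0 : 0 ≤ X := by positivity
  calc X * ‖ξ‖ = X / κ * (κ * ‖ξ‖) := by field_simp
    _ ≤ X / κ * ‖∑' q : Sites₀ t A, (if ∃ z ∈ Λ₀, (q : EuclideanSpace ℝ (Fin 3)) = t 1 + A z then
        forceConst (t 0 - q) ξ else 0)‖ := mul_le_mul_of_nonneg_left hξle (by positivity)


/-- Registered sub-goal carrying this file (crux stmt-AtomisticToContinuum-9332, line `Sketch` v4, part H3d-III of
`stub_green`): the optical vector map is onto with a bound. [folklore] -/
theorem _root_.Summit.AtomisticToContinuum.Crystallization.Theorems.ExcessDecayLiouville.blowdown_opticalVecSurj :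
    ∀ (t : Fin 2 → EuclideanSpace ℝ (Fin 3)) (A : EuclideanSpace ℝ (Fin 3) →L[ℝ] EuclideanSpace ℝ (Fin 3)), Adm₀ A → Inner₀ t A → ∀ (κ : ℝ), 0 < κ → (∀ ξ : EuclideanSpace ℝ (Fin 3), κ * ‖ξ‖ ^ 2 ≤ ∑' z : Λ₀, ⟪forceConst (t 0 - (t 1 + A z)) ξ, ξ⟫) → ∀ η : EuclideanSpace ℝ (Fin 3), ∃ ξ : EuclideanSpace ℝ (Fin 3), (∑' q : Sites₀ t A, (if ∃ z ∈ Λ₀, (q : EuclideanSpace ℝ (Fin 3)) = t 1 + A z then forceConst (t 0 - q) ξ else 0)) = η ∧ κ * ‖ξ‖ ≤ ‖η‖ :=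
  fun _ _ hA hI _ hκ hopt η => opticalVec_surj hA hI hκ hopt η

end

end Blowdown

end Summit.AtomisticToContinuum.Crystallization.Theorems.ExcessDecayLiouville

end
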